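import Literature.MathematicalPhysics.QuantumFieldTheory.Balaban1983to89.B9B8KnitBondAvgDictionary
import Literature.MathematicalPhysics.QuantumFieldTheory.Balaban1983to89.B9B8KnitKernelTranspose
import Literature.MathematicalPhysics.QuantumFieldTheory.Balaban1983to89.B8Thm2TorusMemberWeighted

/-!
# `Balaban1983to89.B9B8KnitBondAvgColumns` — the (B)-line bond junction, file c2 (part II): THE FLAT COLUMNS OF THE KNIT's AVERAGING ARE def-Y's KERNEL
# ENTRIES — at a constant-level-`n` member every level-`n` knit bond `(w, κ)` of the period cell IS an index bond `ι` (`ι₋ = 0 + w`), a single-bond bump of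
# `ℤ^{d+1}` inside the double block of `(w, κ)` has the same flat composite average as the periodic lift of the member's single-bond function, hence
# `LⁿQ_n(1)(X·δ_{(y,μ)})(w, κ) = Lⁿ·qK ι ⟨0 + y, μ⟩·X`, and the `τ`-transpose of that column is the same scalar (`entryT_smul`)

statement-level skeleton of published theorems with citation tags; proofs where landed; nothing here is a claim about the
Yang–Mills mass gap

Sub-row G-B8-T2S (unit `lit-balaban-t2s-1`, gen 7), RULING #10 road, crux (c′) (design `lit-balaban-t2s-1/g7/BLINE-DESIGN-g7.md` §3).  File c2 part I
(`B9B8KnitBondAvgDictionary.linQIter_liftBd_eq_sum_qK`) reads the knit's flat composite averaging of a periodic LIFT through def-Y's kernel `qK`.  The knit's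
transpose `Q_nᵀ` (`B9Eq316AveragingTransposeZd.linCovIterT`) is built from the COLUMNS `X ↦ LⁿQ_n(U₀)(bump y μ X)(c)` of single-bond bumps of `ℤ^{d+1}`
(NOT periodic); inside the double block `B^n(c₋) ∪ B^n(c₊)` (side `2Lⁿ ≤ P₀`, the period) a bump and the periodic lift of the member's single-bond function
have the same block sums, so the flat column is the scalar `Lⁿ·qK ι b` (`b = ⟨0 + y, μ⟩`, `ι` the index bond over `c`), and so is its `τ`-transpose.
Print: [3] (1.18) p. 20; [5] (125), (127) pp. 36–37, (147) p. 40; [4] (3.12)–(3.13) pp. 392–393, (3.16) p. 393; [B6] (2.3)–(2.4) p. 224.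

WHAT IS PROVED (kernel, 0 sorry; theorems only, no `def`, no `… : Prop` fact, no `instance`).
* §1 ★ `exists_ibondY_of_constLev` — at a member of constant level `n` and nominal index `n + 1`, EVERY level-`n` torus bond `⟨0 + w, κ⟩` is an index bond.
* §2 `transl_zero_eq_iff_of_abs_lt` (two integer points closer than the period have the same torus image iff equal), ★ `linQIter_bump_eq_liftBd_single`
  (a bump inside the double block of `c` and the periodic lift of the single-bond function have the same flat composite average at `c`),
  ★★ `linQIter_bump_eq_smul_qK` (`LⁿQ_n(1)(bump y μ X)(w, κ) = (Lⁿ·qK ι ⟨0 + y, μ⟩)·X`).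
* §3 ★★ `entryT_flatColumn_eq_smul_qK` — the `τ`-transpose of that column is the same scalar times the vector (c1's `entryT_smul`).

HONEST SCOPE.  Flat dictionary only; the assembly of the full flat agreement `Q*(1)aQ(1) = (c_fη)²·(QQZdP(1)·♯)♭` (the sum over the two window bonds versus
the sum over all index bonds, via `exists_run_of_qK_ne_zero`) and the curved comparison are NOT here; count-neutral; nothing continuum ∕ ℝ⁴ ∕ OS ∕ mass gap ∕
Clay — the Yang–Mills mass gap is NOT proved here.  NEW file; part I, c1, c2a and the charts are used BY NAME, nothing landed is modified.
-/

noncomputable section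

namespace Literature.MathematicalPhysics.QuantumFieldTheory.Balaban1983to89.B9B8KnitBondAvgColumns

open scoped BigOperators
open Node00
open B7Prop1Explicit renaming Site → LSite
open B7Prop1Explicit (e e_apply boxVec)
open B6KLevelCensusIndexV1 (KIdx)
open B6GlobalChartV1 (PV domT)
open B5Eq118OneStroke (iterBlockOf)
open B15DeterminingSets (embIter)
open B7Prop4Flat (linQIter linQIter_eq_linQ_pow linQ_eq_sum)
open B7Prop5Flat (bump)
open B10Eq27TorusAxialLog (transl transl_apply)
open B9B8KnitBondTransfer (liftBd liftBd_apply)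
open B9B8KnitBondAvgDictionary (linQIter_liftBd_eq_sum_qK sitesPerDir_zero_eq_mul)
open B9B8KnitKernelTranspose (entryT_smul)
open B9Eq316AveragingTransposeZd (entryT)

variable {d ℓ : ℕ} {hd : 1 ≤ d + 1} {hL : Odd (ℓ + 1) ∧ 1 < ℓ + 1} {b₀ b₁ : ℝ}

/-! ## §1 At constant level every level-`n` torus bond is an index bond -/

section IndexBonds

variable (i : KIdx d ℓ hd hL b₀ b₁) {n : ℕ}

/-- ★ **EVERY LEVEL-`n` TORUS BOND IS AN INDEX BOND** of a member of constant level `n ≥ 1` with nominal index `n + 1`: `Ω_n^{(n)} = T` (the level filter is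
`n ≤ lev = n`) and no `n`-block is deep (`Ω_{n+1} = ∅`). [cite: Balaban1984PropagatorsII, (2.3)–(2.4) p.224, dictionary (charts)] -/
theorem exists_ibondY_of_constLev (hD : ∀ x, i.D.lev x = n) (hk : i.k = n + 1) (w : LSite (d + 1)) (κ : Fin (d + 1)) :
    ∃ ι : IBondY i, (ι.1.1 : ℕ) = n ∧ ι.1.2.src = transl (0 : Site (PV d ℓ i.m i.K hd hL) (ι.1.1 : ℕ)) w ∧ ι.1.2.dir = κ := by
  classical
  have hn1 : 1 ≤ n := by have := i.D.one_le_lev (fun _ => 0); rw [hD] at this; exact this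
  have hnk : n ≤ i.k := by omega
  have hle : n + 1 ≤ (PV d ℓ i.m i.K hd hL).m + (PV d ℓ i.m i.K hd hL).K := by have := i.hk; rw [hk] at this; exact this
  -- `Ω_n = T`
  have hOm : ∀ y : Site (PV d ℓ i.m i.K hd hL) n, y ∈ (domT i.hN i.D i.hk).Om n := by
    intro y
    have hn0 : n ≠ 0 := by omega
    simp only [domT, hn0, if_false, hnk, if_true, Finset.mem_filter, Finset.mem_univ, true_and]
    intro x _
    rw [hD]
  -- nothing is deep at level `n`
  have hnd : ∀ y : Site (PV d ℓ i.m i.K hd hL) n, ¬ (domT i.hN i.D i.hk).Deep n y := by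
    intro y hy
    unfold B6SectADomainsV1.Domains.Deep at hy
    have hn0 : n + 1 ≠ 0 := by omega
    have hnk' : n + 1 ≤ i.k := by omega
    simp only [domT, hn0, if_false, hnk', if_true, Finset.mem_filter, Finset.mem_univ, true_and] at hy
    have h := hy (embIter (n + 1) _) (Node00.iterBlockOf_embIter (P := PV d ℓ i.m i.K hd hL) _ hle _)
    rw [hD] at h
    omega
  have hnlt : n < (domT i.hN i.D i.hk).k + 1 := by show n < i.k + 1; omega
  refine ⟨⟨⟨⟨n, hnlt⟩, ⟨transl (0 : Site (PV d ℓ i.m i.K hd hL) n) w, κ⟩⟩, ⟨Or.inl (hOm _), hnd _, hnd _⟩⟩, rfl, rfl, rfl⟩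

end IndexBonds

/-! ## §2 A bump inside the double block of a coarse bond, and its flat column -/

section Columns

variable {m K : ℕ}

/-- two integer points closer than the period coordinatewise have the same image on the torus iff they are equal. [cite: Balaban1987RG1, (0.1) p.251, bookkeeping] -/
theorem transl_zero_eq_iff_of_abs_lt {j : ℕ} {x y : LSite (d + 1)} (h : ∀ ν, |x ν - y ν| < ((PV d ℓ m K hd hL).sitesPerDir j : ℕ)) :
    transl (0 : Site (PV d ℓ m K hd hL) j) x = transl (0 : Site (PV d ℓ m K hd hL) j) y ↔ x = y := by
  constructor
  · intro hxy
    funext ν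
    have hν := congrFun hxy ν
    rw [transl_apply, transl_apply] at hν
    have hc : ((x ν : ℤ) : ZMod ((PV d ℓ m K hd hL).sitesPerDir j)) = ((y ν : ℤ) : ZMod ((PV d ℓ m K hd hL).sitesPerDir j)) :=
      add_left_cancel hν
    rw [ZMod.intCast_eq_intCast_iff_dvd_sub] at hc
    have h0 : y ν - x ν = 0 := Int.eq_zero_of_abs_lt_dvd hc (by rw [abs_sub_comm]; exact h ν)
    omega
  · rintro rfl; rfl

variable {𝔸 : Type} [NormedRing 𝔸] [NormedAlgebra ℂ 𝔸] (i : KIdx d ℓ hd hL b₀ b₁)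

/-- ★ **A BUMP INSIDE THE DOUBLE BLOCK AND THE PERIODIC LIFT OF THE SINGLE-BOND FUNCTION HAVE THE SAME FLAT COLUMN**: if `Lʲw_ν ≤ y_ν < Lʲw_ν + 2Lʲ` for all
`ν` (the fine bond `(y, μ)` lies in the window of the coarse bond at `w`, level `j ≤ m + K`), then
`linQIter L (bump y μ X) j w κ = linQIter L ((δ_{⟨0+y, μ⟩}·X)♯) j w κ` — the period `P₀ = Lʲ·P_j ≥ 2Lʲ` separates the periodic images.
[cite: Balaban1985Averaging, (127) p.37, p.24 (locality); Balaban1985RegularSpaces, p.77 («Ω_j = T_η»)] -/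
theorem linQIter_bump_eq_liftBd_single {j : ℕ} (hj : j ≤ i.m + i.K) (y w : LSite (d + 1)) (μ κ : Fin (d + 1))
    (hy : ∀ ν, (((ℓ + 1) ^ j : ℕ) : ℤ) * w ν ≤ y ν ∧ y ν < (((ℓ + 1) ^ j : ℕ) : ℤ) * w ν + 2 * (((ℓ + 1) ^ j : ℕ) : ℤ)) (X : 𝔸) :
    linQIter (ℓ + 1) (bump y μ X) j w κ =
      linQIter (ℓ + 1) (liftBd i (Pi.single (⟨transl (0 : Site (PV d ℓ i.m i.K hd hL) 0) y, μ⟩ : FBondY i) X)) j w κ := by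
  classical
  rw [linQIter_eq_linQ_pow, linQIter_eq_linQ_pow, linQ_eq_sum, linQ_eq_sum]
  refine Finset.sum_congr rfl fun r _ => ?_
  congr 1
  refine Finset.sum_congr rfl fun s _ => ?_
  set x : LSite (d + 1) := (((ℓ + 1) ^ j : ℕ) : ℤ) • w + boxVec ((ℓ + 1) ^ j) r + ((s : ℕ) : ℤ) • e κ with hx
  -- the two points are closer than the period
  have hP2 : 2 * (ℓ + 1) ^ j ≤ (PV d ℓ i.m i.K hd hL).sitesPerDir 0 := by
    rw [sitesPerDir_zero_eq_mul (d := d) (hd := hd) (hL := hL) hj, mul_comm]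
    refine Nat.mul_le_mul_left _ ?_
    show 2 ≤ 2 * (ℓ + 1) ^ (i.m + i.K - j)
    exact Nat.le_mul_of_pos_right _ (by positivity)
  have hclose : ∀ ν, |x ν - y ν| < ((PV d ℓ i.m i.K hd hL).sitesPerDir 0 : ℕ) := by
    intro ν
    obtain ⟨h1, h2⟩ := hy ν
    have hr : (0 : ℤ) ≤ ((r ν : ℕ) : ℤ) ∧ ((r ν : ℕ) : ℤ) < (((ℓ + 1) ^ j : ℕ) : ℤ) := ⟨by positivity, by exact_mod_cast (r ν).2⟩
    have hs : (0 : ℤ) ≤ ((s : ℕ) : ℤ) ∧ ((s : ℕ) : ℤ) < (((ℓ + 1) ^ j : ℕ) : ℤ) := ⟨by positivity, by exact_mod_cast s.2⟩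
    have hP2' : 2 * (((ℓ + 1) ^ j : ℕ) : ℤ) ≤ (((PV d ℓ i.m i.K hd hL).sitesPerDir 0 : ℕ) : ℤ) := by exact_mod_cast hP2
    have hxν : x ν = (((ℓ + 1) ^ j : ℕ) : ℤ) * w ν + ((r ν : ℕ) : ℤ) + ((s : ℕ) : ℤ) * (if ν = κ then 1 else 0) := by
      simp only [hx, Pi.add_apply, Pi.smul_apply, smul_eq_mul, boxVec, e_apply]
    rw [abs_sub_lt_iff, hxν]
    constructor <;> split_ifs <;> nlinarith
  have hiff := transl_zero_eq_iff_of_abs_lt (d := d) (ℓ := ℓ) (m := i.m) (K := i.K) (hd := hd) (hL := hL) (j := 0) hclose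
  rw [liftBd_apply]
  by_cases hxy : x = y ∧ κ = μ
  · obtain ⟨hxy1, rfl⟩ := hxy
    rw [bump, if_pos ⟨hxy1, rfl⟩, hxy1, Pi.single_eq_same]
  · rw [bump, if_neg hxy, Pi.single_eq_of_ne]
    intro hb
    apply hxy
    have h1 := congrArg PBond.src hb
    have h2 := congrArg PBond.dir hb
    exact ⟨hiff.1 h1, h2⟩

/-- ★★ **THE FLAT COLUMN IS def-Y's KERNEL ENTRY**: for an index bond `ι` over the coarse bond `(w, κ)` (`0 + w = ι₋`, `κ` its direction) and a fine bond `(y, μ)`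
in its window, `LʲQ_j(1)(bump y μ X)(w, κ) = (Lʲ·qK ι ⟨0 + y, μ⟩)·X`. [cite: Balaban1984PropagatorsI, (1.18) p.20; Balaban1985Averaging, (127) p.37, (147) p.40; Balaban1985BackgroundPropagators, (3.12) p.392] -/
theorem linQIter_bump_eq_smul_qK (ι : IBondY i) (w y : LSite (d + 1)) (μ : Fin (d + 1))
    (hw : transl (0 : Site (PV d ℓ i.m i.K hd hL) (ι.1.1 : ℕ)) w = ι.1.2.src)
    (hy : ∀ ν, (((ℓ + 1) ^ (ι.1.1 : ℕ) : ℕ) : ℤ) * w ν ≤ y ν ∧ y ν < (((ℓ + 1) ^ (ι.1.1 : ℕ) : ℕ) : ℤ) * w ν + 2 * (((ℓ + 1) ^ (ι.1.1 : ℕ) : ℕ) : ℤ))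
    (X : 𝔸) :
    linQIter (ℓ + 1) (bump y μ X) (ι.1.1 : ℕ) w ι.1.2.dir =
      (((((ℓ + 1 : ℕ) : ℝ)) ^ (ι.1.1 : ℕ) * qK i ι ⟨transl (0 : Site (PV d ℓ i.m i.K hd hL) 0) y, μ⟩ : ℝ) : ℂ) • X := by
  classical
  have hj : (ι.1.1 : ℕ) ≤ i.m + i.K := B6Ineq2142KLevelV1.lvl_le_mK i.hN i.D i.hk ι
  rw [linQIter_bump_eq_liftBd_single i hj y w μ ι.1.2.dir hy X,
    linQIter_liftBd_eq_sum_qK i ι w hw (Pi.single (⟨transl (0 : Site (PV d ℓ i.m i.K hd hL) 0) y, μ⟩ : FBondY i) X),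
    Complex.ofReal_mul, mul_smul]
  congr 1
  rw [Finset.sum_eq_single (⟨transl (0 : Site (PV d ℓ i.m i.K hd hL) 0) y, μ⟩ : FBondY i)]
  · rw [Pi.single_eq_same]
  · intro f _ hf
    rw [Pi.single_eq_of_ne hf, smul_zero]
  · intro h
    exact absurd (Finset.mem_univ _) h

end Columns

/-! ## §3 The `τ`-transpose of a flat column -/

section Transpose

variable {𝔸 : Type} [CStarAlgebra 𝔸] [FiniteDimensional ℝ 𝔸] (τ : 𝔸 →ₗ[ℂ] ℂ) (i : KIdx d ℓ hd hL b₀ b₁)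

/-- ★★ **THE TRANSPOSE OF A FLAT COLUMN IS THE SAME SCALAR**: with `m := Lʲ·qK ι ⟨0 + y, μ⟩`, the `τ`-transpose (faithful tracial `τ`) of the flat column
`X ↦ LʲQ_j(1)(bump y μ X)(w, κ) = m·X` is `v ↦ m·v`. [cite: Balaban1985BackgroundPropagators, (3.13) p.393, (3.16) p.393; Balaban1985Averaging, (147) p.40] -/
theorem entryT_flatColumn_eq_smul_qK (hτp : ∀ a : 𝔸, a ≠ 0 → 0 < (τ (star a * a)).re) (hτt : ∀ a b : 𝔸, τ (a * b) = τ (b * a))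
    (ι : IBondY i) (w y : LSite (d + 1)) (μ : Fin (d + 1))
    (hw : transl (0 : Site (PV d ℓ i.m i.K hd hL) (ι.1.1 : ℕ)) w = ι.1.2.src)
    (hy : ∀ ν, (((ℓ + 1) ^ (ι.1.1 : ℕ) : ℕ) : ℤ) * w ν ≤ y ν ∧ y ν < (((ℓ + 1) ^ (ι.1.1 : ℕ) : ℕ) : ℤ) * w ν + 2 * (((ℓ + 1) ^ (ι.1.1 : ℕ) : ℕ) : ℤ))
    (v : 𝔸) :
    entryT τ (fun X : 𝔸 => linQIter (ℓ + 1) (bump y μ X) (ι.1.1 : ℕ) w ι.1.2.dir) v =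
      (((((ℓ + 1 : ℕ) : ℝ)) ^ (ι.1.1 : ℕ) * qK i ι ⟨transl (0 : Site (PV d ℓ i.m i.K hd hL) 0) y, μ⟩ : ℝ) : ℂ) • v := by
  have hcol : (fun X : 𝔸 => linQIter (ℓ + 1) (bump y μ X) (ι.1.1 : ℕ) w ι.1.2.dir) =
      fun X : 𝔸 => (((((ℓ + 1 : ℕ) : ℝ)) ^ (ι.1.1 : ℕ) * qK i ι ⟨transl (0 : Site (PV d ℓ i.m i.K hd hL) 0) y, μ⟩ : ℝ) : ℂ) • X :=
    funext fun X => linQIter_bump_eq_smul_qK i ι w y μ hw hy X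
  rw [hcol]
  exact entryT_smul τ hτp hτt _ v

end Transpose

end Literature.MathematicalPhysics.QuantumFieldTheory.Balaban1983to89.B9B8KnitBondAvgColumns
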